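import Literature.Topology.FourManifolds.TwistedSurgeryProjectivePlane
import Literature.Topology.FourManifolds.CircleSurgerySimplyConnected
import Literature.AlgebraicTopology.SingularHomology.OrientationCover
import HarnessLib

/-!
# The twisted surgery of a simply connected closed 4-manifold has an odd intersection form
# (existential form: the hypothesis `hodd` of the parity chain, discharged)

Topic `Literature/Topology/FourManifolds` (barrier seat
`provefact-Literature.Barriers.SmoothPoincare4.Stab-ad8c696e34`, seat 0).  The parity route to
Wall's stabilisation theorem and to `StableBarrierFour` (`HCobordismEvenLevels.lean`,
`HCobordismEvenLevelsChain.lean`, `StableInvariantsBlindParity.lean`) was proved relative to the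
hypothesis

> (`hodd`) `∀ V` simply connected closed smooth 4-manifold, `∀ C : StdChart V`,
> `∃ μ' : HomologicalOrientation ℤ (C.nbhd.linTwist OpLoop.twist).Surgered 4`, `Q_{μ'}` is odd.

`TwistedSurgeryProjectivePlane.lean` proves the oddness for EVERY orientation
(`isOdd_intersectionForm_twistSurgered`: the twisted surgery contains `ℂℙ² ∖ {pt}`;
R. C. Kirby, *The Topology of 4-Manifolds* (1989), Ch. VIII p. 50, `S² ×~ S²`; Gompf–Stipsicz
1999 §5.2, §1.2), and `CircleSurgerySimplyConnected.lean` that the surgered manifold is simply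
connected (Kosinski 1993, X.2.2), hence `ℤ`-orientable (Hatcher 2002, Prop. 3.25,
`isOrientableOver_int_of_simplyConnectedSpace_holds`).  Together:

* `exists_isOdd_intersectionForm_twistSurgered` — the existential form for one `V`, `C`;
* `forall_exists_isOdd_intersectionForm_twistSurgered` — **`hodd` verbatim**, so that every
  statement of the parity chain holds unconditionally, e.g.
  `stableBarrierFour_of_thetaFour_of_isOdd_twist hΘ forall_exists_isOdd_intersectionForm_twistSurgered`.

Everything is proved; no definition, no named fact.

## References

* R. C. Kirby, *The Topology of 4-Manifolds*, LNM 1374 (1989), Ch. VIII p. 50, Ch. X p. 55.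
  [Kirby1989]
* A. Kosinski, *Differential Manifolds* (1993), Ch. X §2, Thm. (2.2) (proof). [Kosinski1993]
* A. Hatcher, *Algebraic Topology* (2002), Prop. 3.25. [HatcherAT2002]
-/

open scoped Manifold ContDiff
open Literature.AlgebraicTopology.SingularHomology

noncomputable section

namespace Literature.Topology.FourManifolds

/-- **The twisted surgery of a simply connected closed smooth 4-manifold has an odd intersection
form for some (indeed every) `ℤ`-orientation**: `(C.nbhd.linTwist OpLoop.twist).Surgered` is
simply connected (`CircleNbhd.simplyConnectedSpace_surgered`), hence `ℤ`-orientable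
(`isOrientableOver_int_of_simplyConnectedSpace_holds`), and every orientation is odd
(`isOdd_intersectionForm_twistSurgered`). [cite: Kirby1989, Ch. VIII p. 50] [cite: Kosinski1993, Ch. X §2, Thm. 2.2 (proof)] [cite: HatcherAT2002, Prop. 3.25] -/
theorem exists_isOdd_intersectionForm_twistSurgered {X : Type} [TopologicalSpace X] [T2Space X]
    [CompactSpace X] [ChartedSpace (EuclideanSpace ℝ (Fin 4)) X] [IsManifold (𝓡 4) ∞ X]
    [SimplyConnectedSpace X] (C : StdChart X) :
    ∃ μ' : HomologicalOrientation ℤ (C.nbhd.linTwist OpLoop.twist).Surgered 4,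
      (intersectionForm two_add_two_eq_four μ').IsOdd := by
  haveI := (C.nbhd.linTwist OpLoop.twist).simplyConnectedSpace_surgered
  obtain ⟨μ'⟩ := isOrientableOver_int_of_simplyConnectedSpace_holds
    (C.nbhd.linTwist OpLoop.twist).Surgered (n := 4)
  exact ⟨μ', isOdd_intersectionForm_twistSurgered C μ'⟩

/-- **The hypothesis `hodd` of the parity chain, verbatim** (for every simply connected closed
smooth 4-manifold `V` and chart `C`, the twisted surgery has an odd intersection form for some
orientation): feed it to `Cobordism.IsHCobordism.isConnectedSum_levels_of_isEven_of_isOdd_twist`,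
`exists_isStabilization_of_isHCobordant_of_isEven_of_isOdd_twist`,
`Literature.Barriers.SmoothPoincare4.stableBarrierFour_of_thetaFour_of_isOdd_twist`, … .
[cite: Kirby1989, Ch. VIII p. 50 and Ch. X p. 55] -/
theorem forall_exists_isOdd_intersectionForm_twistSurgered :
    ∀ (V : Type) [TopologicalSpace V] [T2Space V] [SecondCountableTopology V] [CompactSpace V]
      [ChartedSpace (EuclideanSpace ℝ (Fin 4)) V] [IsManifold (𝓡 4) ∞ V] [SimplyConnectedSpace V]
      (C : StdChart V),
      ∃ μ' : HomologicalOrientation ℤ (C.nbhd.linTwist OpLoop.twist).Surgered 4,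
        (intersectionForm two_add_two_eq_four μ').IsOdd :=
  fun _ _ _ _ _ _ _ _ C => exists_isOdd_intersectionForm_twistSurgered C

end Literature.Topology.FourManifolds

end
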